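import Summits.NavierStokesRegularity.FunctionalMining.TopEigHeatStable
import Summits.NavierStokesRegularity.FunctionalMining.TopEigHeatCoerciveRate
import Summits.NavierStokesRegularity.FunctionalMining.TopEigHeatCoerciveSymm
import Summits.NavierStokesRegularity.FunctionalMining.SaturatingLawSup
import HarnessLib

/-!
# FunctionalMining — the heat-coercivity CONSTANT `C_λ(q)` of Lemma L-λ (dict seat g25, staged)

HONEST FRAMING. Search for candidate a priori estimates; no regularity claim. Nothing about
Navier–Stokes is proved or asserted here; every statement below is real-number bookkeeping over the
tree's STATIC heat-coercivity node `HeatCoercive Φ c` (`TopEigHeatCoercive.lean`) and the three kernel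
facts already landed about the rate set of the one open node of the A12 `T_LD` classification,
Lemma L-λ(q) = `TopEigHeatCoercivePos q` (`∃ c > 0, TopEigHeatCoercive q c`):

* monotonicity in the rate (`TopEigHeatCoercive.mono`, dict g13, p236628),
* rate `0` is admissible for every real `q ≥ 1` — the eigenvalue cores pass the static heat sieve
  (`TopEig.topEigHeatCoercive_zero`, prove g17, p317514),
* every admissible rate is `≤ 4π²q`, the first-shell value (`TopEig.topEigHeatCoercive_rate_le`,
  prove g16, p314998),
* the `v ↦ −v` symmetry `NegBotEigHeatCoercive q c ↔ TopEigHeatCoercive q c` (dict g18,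
  `TopEigHeatCoerciveSymm`).

WHAT THIS FILE ADDS (dictionary grammar: an `∃`-node becomes a NAMED CONSTANT with a kernel WINDOW, as
`stretchingSupConst` / `laminateSupConst` did for K1-Q1):

* `heatRate Φ := sSup {c | HeatCoercive Φ c}` for any functional `Φ`; for a non-negative `Φ` passing the
  heat sieve the supremum is ATTAINED (`heatCoercive_heatRate` — the admissible set is an intersection
  of closed half-lines `{c | c·Φ v ≤ D(v)}`, proved here without topology), so the admissible set is
  exactly the closed ray `Iic (heatRate Φ)` once it is bounded (`heatRateSet_eq_Iic`);
* **`TopEig.topEigHeatRate q` =: `C_λ(q)`**, the best rate of the `λ₁^q` core on `T³` (unit-torus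
  units), with the KERNEL WINDOW **`0 ≤ C_λ(q) ≤ 4π²q`** for every real `q ≥ 1`
  (`topEigHeatRate_mem_Icc`), attainment `TopEigHeatCoercive q (C_λ(q))`, the exact description of the
  rate set `{c | TopEigHeatCoercive q c} = Iic (C_λ(q))` (`setOf_topEigHeatCoercive_eq_Iic`), and
  **`TopEigHeatCoercivePos q ↔ 0 < C_λ(q)`** (`topEigHeatCoercivePos_iff_rate_pos`), equivalently
  `¬ L-λ(q) ↔ C_λ(q) = 0`;
* `negBotEigHeatRate q = topEigHeatRate q` (the `−λ₃` family has the same constant), so the SIX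
  conditional rows `ES.lam1.q / ES.neglam3.q | T_LD | G1` (`q = 2, 3, 4`) hang on the THREE REAL NUMBERS
  `C_λ(2), C_λ(3), C_λ(4)` being positive (`sixRows_of_rate_pos`, by the tree's
  `topEigMoment_saturatingLawSup_of_heatCoercivePos` / `negBot…`, prove g17 p317110).

So the sentence of record "admissible rates ⊆ [0, 4π²q] ∋ 0, L-λ(q) = a positive member" reads, by
name: the admissible set is the ray `(−∞, C_λ(q)]` with `C_λ(q) ∈ [0, 4π²q]`, and L-λ(q) says
`C_λ(q) > 0`.

NUMBERS (by value, NOT kernel, labelled): in SIEVELD units (`(ℝ/2πℤ)³`, §3.4b) `C_λ(q) = (2π)²·inf_u R_q`,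
so the dimensionless position of the constant in its window is `θ_λ(q) := C_λ(q)/(4π²q) = (inf_u R_q)/q
∈ [0, 1]`; static-descent records of the cell (candidate UPPER values only, two-party where stated, no
certificate): `inf R₂ ≤ 0.5800` (0.57991, `K = 128`, j105166, two-party) ⇒ `θ_λ(2) ≤ 0.290`;
`inf R₃ ≤ 0.8827` ⇒ `θ_λ(3) ≤ 0.2943`; `inf R₄ ≤ 1.0180` ⇒ `θ_λ(4) ≤ 0.2545`; shift-averaged
Laplacian-form census values at `q = 2` (ruling Q-1 / R29-5″): `B(64) = 0.55877(4)`, `B(128) = 0.4586(4)`,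
`B(192) = 0.4328(7)`. None of these is a lower bound; `C_λ(q) > 0` versus `= 0` is OPEN, and its
sharp-interface reduction is the combinatorial question E2 (SIEVELD §3.4b (6)–(8), D5).

[ours: `pub-nsfunc` dict seat g25, 2026-08-22; bookkeeping over p236628, p314998, p317514, p317110 and
`TopEigHeatCoerciveSymm`. No literature claim is made: L-λ is an internally-minted OPEN QUESTION.]
-/

noncomputable section

namespace Summit.NavierStokesRegularity.FunctionalMining

open MeasureTheory Set Real Literature.Analysis.FunctionSpaces Literature.Analysis.FluidPDE

variable {d : Type*} [Fintype d] [DecidableEq d]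

/-! ### The best rate of a heat-coercive functional -/

/-- The set of admissible heat-coercivity rates of a functional `Φ`. [ours, bookkeeping] -/
def heatRateSet (Φ : (UnitAddTorus d → EuclideanSpace ℝ d) → ℝ) : Set ℝ :=
  {c : ℝ | HeatCoercive (d := d) Φ c}

/-- **`heatRate Φ := sup {c | HeatCoercive Φ c}`** — the best heat-coercivity rate of `Φ` (Mathlib's
`Real.sSup` junk value `0` on an empty or unbounded set). [ours, bookkeeping] -/
def heatRate (Φ : (UnitAddTorus d → EuclideanSpace ℝ d) → ℝ) : ℝ :=
  sSup (heatRateSet (d := d) Φ)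

/-- Membership in `heatRateSet Φ` is the heat-coercivity predicate `HeatCoercive Φ c` (by definition). [ours, bookkeeping] -/
theorem mem_heatRateSet_iff {Φ : (UnitAddTorus d → EuclideanSpace ℝ d) → ℝ} {c : ℝ} :
    c ∈ heatRateSet (d := d) Φ ↔ HeatCoercive (d := d) Φ c :=
  Iff.rfl

/-- The admissible rates of a non-negative functional form a down-set. [ours, bookkeeping] -/
theorem heatRateSet_isLowerSet {Φ : (UnitAddTorus d → EuclideanSpace ℝ d) → ℝ} (hΦ : ∀ v, 0 ≤ Φ v) :
    IsLowerSet (heatRateSet (d := d) Φ) :=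
  fun _ _ hle h => HeatCoercive.mono h hΦ hle

/-- An admissible rate is at most the best rate (when the admissible set is bounded above).
[ours, bookkeeping] -/
theorem HeatCoercive.le_heatRate {Φ : (UnitAddTorus d → EuclideanSpace ℝ d) → ℝ} {c : ℝ}
    (h : HeatCoercive (d := d) Φ c) (hb : BddAbove (heatRateSet (d := d) Φ)) :
    c ≤ heatRate (d := d) Φ :=
  le_csSup hb h

/-- **The supremum is attained**: a non-negative functional passing the heat sieve (rate `0`) is
heat-coercive at its best rate. The admissible set is `⋂_v {c | c · Φ v ≤ D(v)}`, an intersection of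
closed rays; elementary proof: at a field with `Φ v > 0` every admissible `c` is `≤ D(v)/Φ v`, hence so
is their supremum; at a field with `Φ v = 0` the claim is the heat sieve `0 ≤ D(v)`. No boundedness
hypothesis is needed (an unbounded admissible set forces `Φ v = 0` at every test field). [ours, bookkeeping] -/
theorem heatCoercive_heatRate {Φ : (UnitAddTorus d → EuclideanSpace ℝ d) → ℝ} (hΦ : ∀ v, 0 ≤ Φ v)
    (h0 : HeatCoercive (d := d) Φ 0) : HeatCoercive (d := d) Φ (heatRate (d := d) Φ) := by
  intro hd v hv hdiv hmean
  have hne : (heatRateSet (d := d) Φ).Nonempty := ⟨0, h0⟩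
  have hD : 0 ≤ heatDissipation Φ v := by simpa only [zero_mul] using h0 hd v hv hdiv hmean
  rcases (hΦ v).eq_or_lt with h | h
  · rw [← h, mul_zero]; exact hD
  · rw [heatRate, ← le_div_iff₀ h]
    exact csSup_le hne fun c hc => (le_div_iff₀ h).2 (hc hd v hv hdiv hmean)

/-- **`HeatCoercive Φ c ↔ c ≤ heatRate Φ`** for a non-negative functional passing the heat sieve with a
bounded admissible set. [ours, bookkeeping] -/
theorem heatCoercive_iff_le_heatRate {Φ : (UnitAddTorus d → EuclideanSpace ℝ d) → ℝ}
    (hΦ : ∀ v, 0 ≤ Φ v) (h0 : HeatCoercive (d := d) Φ 0) (hb : BddAbove (heatRateSet (d := d) Φ))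
    {c : ℝ} : HeatCoercive (d := d) Φ c ↔ c ≤ heatRate (d := d) Φ :=
  ⟨fun h => h.le_heatRate hb, fun hc => (heatCoercive_heatRate hΦ h0).mono hΦ hc⟩

/-- The admissible set is exactly the closed ray `(−∞, heatRate Φ]`. [ours, bookkeeping] -/
theorem heatRateSet_eq_Iic {Φ : (UnitAddTorus d → EuclideanSpace ℝ d) → ℝ} (hΦ : ∀ v, 0 ≤ Φ v)
    (h0 : HeatCoercive (d := d) Φ 0) (hb : BddAbove (heatRateSet (d := d) Φ)) :
    heatRateSet (d := d) Φ = Iic (heatRate (d := d) Φ) :=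
  Set.ext fun _ => heatCoercive_iff_le_heatRate hΦ h0 hb

/-- The best rate of a functional passing the heat sieve is non-negative (bounded case). [ours, bookkeeping] -/
theorem heatRate_nonneg {Φ : (UnitAddTorus d → EuclideanSpace ℝ d) → ℝ} (h0 : HeatCoercive (d := d) Φ 0)
    (hb : BddAbove (heatRateSet (d := d) Φ)) : 0 ≤ heatRate (d := d) Φ :=
  le_csSup hb h0

/-- The best rate is invariant under `Φ ↦ Φ ∘ Neg` (tree: `heatCoercive_comp_neg_iff`). [ours, bookkeeping] -/
theorem heatRate_comp_neg (Φ : (UnitAddTorus d → EuclideanSpace ℝ d) → ℝ) :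
    heatRate (d := d) (fun w => Φ (-w)) = heatRate (d := d) Φ := by
  unfold heatRate heatRateSet
  simp only [heatCoercive_comp_neg_iff]

/-! ### The constant `C_λ(q)` of the `λ₁` / `−λ₃` cores on `T³` and its kernel window -/

namespace TopEig

/-- **`C_λ(q) := sup {c | TopEigHeatCoercive q c}`** — the heat-coercivity constant of the core
`∫(λ₁⁺)^q` on `T³` (unit-torus units; `= (2π)² · inf_u R_q` of SIEVELD §3.4b). [ours, bookkeeping] -/
def topEigHeatRate (q : ℝ) : ℝ :=
  heatRate (d := Fin 3) (torusTopEigMoment q)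

/-- The same constant for the `−λ₃` core `∫((−λ₃)⁺)^q` (equal to `C_λ(q)`, `negBotEigHeatRate_eq`).
[ours, bookkeeping] -/
def negBotEigHeatRate (q : ℝ) : ℝ :=
  heatRate (d := Fin 3) (torusNegBotEigMoment q)

/-- `C_λ(q)` is literally `sSup {c | TopEigHeatCoercive q c}`. [ours, bookkeeping] -/
theorem topEigHeatRate_eq_sSup (q : ℝ) :
    topEigHeatRate q = sSup {c : ℝ | TopEigHeatCoercive (d := Fin 3) q c} :=
  rfl

/-- The admissible rates of the `λ₁^q` core are bounded above by the first-shell value `4π²q`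
(tree: `topEigHeatCoercive_rate_le`, p314998). [ours, bookkeeping] -/
theorem bddAbove_setOf_topEigHeatCoercive {q : ℝ} (hq : 1 ≤ q) :
    BddAbove {c : ℝ | TopEigHeatCoercive (d := Fin 3) q c} :=
  ⟨4 * π ^ 2 * q, fun _ hc => topEigHeatCoercive_rate_le hq hc⟩

/-- **Attainment: `TopEigHeatCoercive q (C_λ(q))`** for every real `q ≥ 1` (heat sieve p317514 +
`heatCoercive_heatRate`). [ours, bookkeeping] -/
theorem topEigHeatCoercive_topEigHeatRate {q : ℝ} (hq : 1 ≤ q) :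
    TopEigHeatCoercive (d := Fin 3) q (topEigHeatRate q) :=
  heatCoercive_heatRate (torusTopEigMoment_nonneg q) (topEigHeatCoercive_zero hq)

/-- **`TopEigHeatCoercive q c ↔ c ≤ C_λ(q)`** (`q ≥ 1`). [ours, bookkeeping] -/
theorem topEigHeatCoercive_iff_le_rate {q c : ℝ} (hq : 1 ≤ q) :
    TopEigHeatCoercive (d := Fin 3) q c ↔ c ≤ topEigHeatRate q :=
  heatCoercive_iff_le_heatRate (torusTopEigMoment_nonneg q) (topEigHeatCoercive_zero hq)
    (bddAbove_setOf_topEigHeatCoercive hq)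

/-- **The rate set is the closed ray: `{c | TopEigHeatCoercive q c} = Iic (C_λ(q))`** (`q ≥ 1`).
[ours, bookkeeping] -/
theorem setOf_topEigHeatCoercive_eq_Iic {q : ℝ} (hq : 1 ≤ q) :
    {c : ℝ | TopEigHeatCoercive (d := Fin 3) q c} = Iic (topEigHeatRate q) :=
  Set.ext fun _ => topEigHeatCoercive_iff_le_rate hq

/-- Lower end of the window: `0 ≤ C_λ(q)` (`q ≥ 1`; p317514). [ours, bookkeeping] -/
theorem topEigHeatRate_nonneg {q : ℝ} (hq : 1 ≤ q) : 0 ≤ topEigHeatRate q :=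
  (topEigHeatCoercive_iff_le_rate hq).1 (topEigHeatCoercive_zero hq)

/-- Upper end of the window: `C_λ(q) ≤ 4π²q` (`q ≥ 1`; p314998). [ours, bookkeeping] -/
theorem topEigHeatRate_le {q : ℝ} (hq : 1 ≤ q) : topEigHeatRate q ≤ 4 * π ^ 2 * q :=
  topEigHeatCoercive_rate_le hq (topEigHeatCoercive_topEigHeatRate hq)

/-- **KERNEL WINDOW of the constant: `C_λ(q) ∈ [0, 4π²q]`** for every real `q ≥ 1`. [ours, bookkeeping] -/
theorem topEigHeatRate_mem_Icc {q : ℝ} (hq : 1 ≤ q) : topEigHeatRate q ∈ Icc 0 (4 * π ^ 2 * q) :=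
  ⟨topEigHeatRate_nonneg hq, topEigHeatRate_le hq⟩

/-- The dimensionless position of the constant in its window, `θ_λ(q) := C_λ(q)/(4π²q) ∈ [0, 1]`
(`= (inf_u R_q)/q` in SIEVELD units; `q ≥ 1`). [ours, bookkeeping] -/
theorem topEigHeatRate_div_mem_unitInterval {q : ℝ} (hq : 1 ≤ q) :
    topEigHeatRate q / (4 * π ^ 2 * q) ∈ Icc (0 : ℝ) 1 := by
  have hpos : 0 < 4 * π ^ 2 * q := by positivity
  exact ⟨div_nonneg (topEigHeatRate_nonneg hq) hpos.le,
    (div_le_one hpos).2 (topEigHeatRate_le hq)⟩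

/-- **Lemma L-λ(q) ⟺ the constant is positive: `TopEigHeatCoercivePos q ↔ 0 < C_λ(q)`** (`q ≥ 1`).
[ours, bookkeeping] -/
theorem topEigHeatCoercivePos_iff_rate_pos {q : ℝ} (hq : 1 ≤ q) :
    TopEigHeatCoercivePos (d := Fin 3) q ↔ 0 < topEigHeatRate q := by
  constructor
  · rintro ⟨c, hc, h⟩
    exact hc.trans_le ((topEigHeatCoercive_iff_le_rate hq).1 h)
  · exact fun h => ⟨_, h, topEigHeatCoercive_topEigHeatRate hq⟩

/-- Equivalently: **`¬ L-λ(q) ↔ C_λ(q) = 0`** (`q ≥ 1`) — the negative side of the open node is the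
statement that the window's lower end is the value. [ours, bookkeeping] -/
theorem not_topEigHeatCoercivePos_iff_rate_eq_zero {q : ℝ} (hq : 1 ≤ q) :
    ¬ TopEigHeatCoercivePos (d := Fin 3) q ↔ topEigHeatRate q = 0 := by
  rw [topEigHeatCoercivePos_iff_rate_pos hq, not_lt]
  exact ⟨fun h => le_antisymm h (topEigHeatRate_nonneg hq), fun h => h.le⟩

/-- A positive admissible rate is a LOWER bound for the constant; a refuted rate is a STRICT UPPER
bound: `¬ TopEigHeatCoercive q c → C_λ(q) < c` (`q ≥ 1`). This is how a future certificate on either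
side would be booked against the window. [ours, bookkeeping] -/
theorem topEigHeatRate_lt_of_not {q c : ℝ} (hq : 1 ≤ q) (h : ¬ TopEigHeatCoercive (d := Fin 3) q c) :
    topEigHeatRate q < c := by
  by_contra hle
  exact h ((topEigHeatCoercive_iff_le_rate hq).2 (not_lt.1 hle))

/-- **One test field bounds the constant from above: `C_λ(q) ≤ D(v) / Φ_q(v)`** for every smooth,
divergence-free, zero-mean field `v` on `T³` with `Φ_q(v) = ∫(λ₁⁺)^q > 0` (`q ≥ 1`; the best rate is
admissible, `topEigHeatCoercive_topEigHeatRate`, and admissibility at `v` is `C_λ(q) · Φ_q(v) ≤ D(v)`).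
This is the BOOKING FORM of an explicit-field upper bound: the kernel ceiling `4π²q` (tree
`TopEig.topEigHeatCoercive_rate_le`, p314998) is the single-shell instance; the dict note LN-2 names the
closed-form two-mode family `u_ε = (sin z, sin x + ε sin(x − z), 0)` with SIEVELD ratio
`R₂(u_ε) = 2 − 2Iε + O(ε²)`, `I = ⟨cos²x cos²z / √(cos²x + cos²z)⟩ = 0.2101394` (pen, first order) and
`R₂(u_{0.12}) = 1.9735` by value (one-party numerics, NOT a certificate) — a certified evaluation of that
one ratio would give `C_λ(2) < 8π²` through this lemma. [ours, bookkeeping] -/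
theorem topEigHeatRate_le_ratio {q : ℝ} (hq : 1 ≤ q)
    (v : UnitAddTorus (Fin 3) → EuclideanSpace ℝ (Fin 3)) (hv : Torus.IsSmooth v)
    (hdiv : Torus.IsDivFree v) (hmean : Torus.HasZeroMean v) (hΦ : 0 < torusTopEigMoment q v) :
    topEigHeatRate q ≤ heatDissipation (torusTopEigMoment q) v / torusTopEigMoment q v := by
  rw [le_div_iff₀ hΦ]
  exact topEigHeatCoercive_topEigHeatRate hq (by simp) v hv hdiv hmean

/-- **Strict form: a test field with `D(v) < c · Φ_q(v)` gives `C_λ(q) < c`** (`q ≥ 1`). With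
`c = 4π²q` this is the shape of the open strict upper end `C_λ(q) < 4π²q` (the analogue of
`not_stretchingSupSharp_fin3` for `C⋆`): ONE explicit field with SIEVELD ratio `R_q < q` suffices.
[ours, bookkeeping] -/
theorem topEigHeatRate_lt_of_ratio_lt {q c : ℝ} (hq : 1 ≤ q)
    (v : UnitAddTorus (Fin 3) → EuclideanSpace ℝ (Fin 3)) (hv : Torus.IsSmooth v)
    (hdiv : Torus.IsDivFree v) (hmean : Torus.HasZeroMean v) (hΦ : 0 < torusTopEigMoment q v)
    (h : heatDissipation (torusTopEigMoment q) v < c * torusTopEigMoment q v) :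
    topEigHeatRate q < c :=
  lt_of_le_of_lt (topEigHeatRate_le_ratio hq v hv hdiv hmean hΦ) ((div_lt_iff₀ hΦ).2 h)

/-- **The two families have the same constant: `negBotEigHeatRate q = C_λ(q)`** (every real `q`;
tree `TopEigHeatCoerciveSymm`). [ours, bookkeeping] -/
theorem negBotEigHeatRate_eq (q : ℝ) : negBotEigHeatRate q = topEigHeatRate q := by
  unfold negBotEigHeatRate topEigHeatRate
  rw [torusNegBotEigMoment_eq_comp_neg, heatRate_comp_neg]

/-- `NegBotEigHeatCoercive q c ↔ c ≤ C_λ(q)` (`q ≥ 1`). [ours, bookkeeping] -/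
theorem negBotEigHeatCoercive_iff_le_rate {q c : ℝ} (hq : 1 ≤ q) :
    NegBotEigHeatCoercive (d := Fin 3) q c ↔ c ≤ topEigHeatRate q := by
  rw [negBotEigHeatCoercive_iff, topEigHeatCoercive_iff_le_rate hq]

/-- `NegBotEigHeatCoercivePos q ↔ 0 < C_λ(q)` (`q ≥ 1`). [ours, bookkeeping] -/
theorem negBotEigHeatCoercivePos_iff_rate_pos {q : ℝ} (hq : 1 ≤ q) :
    NegBotEigHeatCoercivePos (d := Fin 3) q ↔ 0 < topEigHeatRate q := by
  rw [negBotEigHeatCoercivePos_iff, topEigHeatCoercivePos_iff_rate_pos hq]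

/-! ### The six conditional `T_LD` rows hang on three numbers -/

/-- For every real `q ≥ 2`: `0 < C_λ(q)` gives BOTH eigenvalue-core `T_LD` rows at exponent `q` in the
one-sided-derivative-value form (tree p317110: `topEigMoment_saturatingLawSup_of_heatCoercivePos` and
its `−λ₃` twin). [ours, bookkeeping] -/
theorem saturatingLawSup_pair_of_rate_pos {q : ℝ} (hq : 2 ≤ q) (h : 0 < topEigHeatRate q) :
    (∃ κ : ℝ, 0 ≤ κ ∧
      SaturatingLawSup (d := Fin 3) (torusTopEigMoment q) (2 * q - 3) ((3 * q - 3) / (2 * q - 3)) κ) ∧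
    (∃ κ : ℝ, 0 ≤ κ ∧
      SaturatingLawSup (d := Fin 3) (torusNegBotEigMoment q) (2 * q - 3) ((3 * q - 3) / (2 * q - 3)) κ) :=
  ⟨topEigMoment_saturatingLawSup_of_heatCoercivePos hq
      ((topEigHeatCoercivePos_iff_rate_pos (by linarith)).2 h),
    negBotEigMoment_saturatingLawSup_of_heatCoercivePos hq
      ((negBotEigHeatCoercivePos_iff_rate_pos (by linarith)).2 h)⟩

/-- **The six K0 rows `ES.lam1.q / ES.neglam3.q | T_LD | G1`, `q = 2, 3, 4`, conditional on the
positivity of the three real numbers `C_λ(2), C_λ(3), C_λ(4)`** (exponents `(σ, γ) = (1, 3), (3, 2),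
(5, 9/5)`; tree rows p317110). [ours, bookkeeping] -/
theorem sixRows_of_rate_pos :
    (0 < topEigHeatRate 2 →
      (∃ κ : ℝ, 0 ≤ κ ∧ SaturatingLawSup (d := Fin 3) (torusTopEigMoment 2) 1 3 κ) ∧
      (∃ κ : ℝ, 0 ≤ κ ∧ SaturatingLawSup (d := Fin 3) (torusNegBotEigMoment 2) 1 3 κ)) ∧
    (0 < topEigHeatRate 3 →
      (∃ κ : ℝ, 0 ≤ κ ∧ SaturatingLawSup (d := Fin 3) (torusTopEigMoment 3) 3 2 κ) ∧
      (∃ κ : ℝ, 0 ≤ κ ∧ SaturatingLawSup (d := Fin 3) (torusNegBotEigMoment 3) 3 2 κ)) ∧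
    (0 < topEigHeatRate 4 →
      (∃ κ : ℝ, 0 ≤ κ ∧ SaturatingLawSup (d := Fin 3) (torusTopEigMoment 4) 5 (9 / 5) κ) ∧
      (∃ κ : ℝ, 0 ≤ κ ∧ SaturatingLawSup (d := Fin 3) (torusNegBotEigMoment 4) 5 (9 / 5) κ)) := by
  refine ⟨fun h => ?_, fun h => ?_, fun h => ?_⟩
  · exact ⟨topEigMoment_saturatingLawSup_rows.1 ((topEigHeatCoercivePos_iff_rate_pos (by norm_num)).2 h),
      negBotEigMoment_saturatingLawSup_rows.1 ((negBotEigHeatCoercivePos_iff_rate_pos (by norm_num)).2 h)⟩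
  · exact ⟨topEigMoment_saturatingLawSup_rows.2.1 ((topEigHeatCoercivePos_iff_rate_pos (by norm_num)).2 h),
      negBotEigMoment_saturatingLawSup_rows.2.1
        ((negBotEigHeatCoercivePos_iff_rate_pos (by norm_num)).2 h)⟩
  · exact ⟨topEigMoment_saturatingLawSup_rows.2.2 ((topEigHeatCoercivePos_iff_rate_pos (by norm_num)).2 h),
      negBotEigMoment_saturatingLawSup_rows.2.2
        ((negBotEigHeatCoercivePos_iff_rate_pos (by norm_num)).2 h)⟩

end TopEig

end Summit.NavierStokesRegularity.FunctionalMining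

end
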